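import Summits.HubbardSuperconductivity.HubbardLadder.PsdCert
import Summits.HubbardSuperconductivity.HubbardLadder.ClusterCutFlipRule
import HarnessLib

/-!
# Cluster pair-cuts, piece [C](c), part 1: the block-entry shortcut and bitmask configurations

HONEST FRAMING: ladder R1–R4 with certified numbers; no claim on H/H₀.  Cell pub-hubbard, lane r2-eng-1 (g12); design memo
`pub-hubbard-r2-eng-1/psdcert-g12/C-SPEC-g12.md` §3 / §7.  Infrastructure; it certifies no cell by itself.

§1 THE SHORTCUT that makes the per-piece block matrices cheap for the kernel: if `P` is a Hermitian idempotent commuting with `X`, a frame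
column `W_k = a • P e_x` (one representative configuration `x` per column) and any `w` in the range of `P`, then
`⟨W_k, X w⟩ = conj a · (X w)(x)` and `⟨W_k, w⟩ = conj a · w(x)` — so an entry of `Φᴴ X Φ` needs only the `x`-th entry of `X` applied to a sparse
column (for the oct12 cuts: ≤ 67 neighbours × ≤ 16 supports), never the whole sector (`blockEntry_eq`, `gramEntry_eq`; validated numerically on all ten
pieces of cut it4_s4b, `psdcert-g12/poc-oct12-it4/`, scaling `a = 16` for the character pieces, `8` for the E pieces).
§2 BITMASK CONFIGURATIONS: the kernel-side data are naturals `b < 2^N`; `decodeBits N b : Fin N → Fin 2` reads bit `i` (`1 = ↓`), with the weight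
(`# ↓`) and basic lemmas.  The sparse columns / orbit sums / span check of [C](c) part 2 are built on these.
All statements [folklore].
-/

namespace Summit.HubbardSuperconductivity.HubbardLadder.ClusterCut

open Matrix Complex

/-! ## §1 Entries of a symmetry-adapted block from one representative -/

section Shortcut

variable {ι : Type*} [Fintype ι] [DecidableEq ι]

omit [Fintype ι] in
/-- `star e_x = e_x` for the standard basis vector with entry `1`. [folklore] -/
theorem star_single_one (x : ι) : star (Pi.single x 1 : ι → ℂ) = Pi.single x 1 := by
  ext i
  by_cases h : i = x
  · subst h; simp
  · simp [h]

/-- **Representative formula for the `X`-block**: `P` Hermitian, `P·X = X·P`, `w` fixed by `P` ⟹ `⟨P e_x, X w⟩ = (X w) x`. [folklore] -/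
theorem rep_dotProduct_mulVec {P X : Matrix ι ι ℂ} (hP : Pᴴ = P) (hPX : P * X = X * P) {w : ι → ℂ}
    (hw : P *ᵥ w = w) (x : ι) :
    star (P *ᵥ Pi.single x 1) ⬝ᵥ (X *ᵥ w) = (X *ᵥ w) x := by
  rw [star_mulVec, hP, ← dotProduct_mulVec, mulVec_mulVec, hPX, ← mulVec_mulVec, hw, star_single_one,
    single_dotProduct, one_mul]

/-- **Representative formula for the Gram block**: `P` Hermitian, `w` fixed by `P` ⟹ `⟨P e_x, w⟩ = w x`. [folklore] -/
theorem rep_dotProduct {P : Matrix ι ι ℂ} (hP : Pᴴ = P) {w : ι → ℂ} (hw : P *ᵥ w = w) (x : ι) :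
    star (P *ᵥ Pi.single x 1) ⬝ᵥ w = w x := by
  rw [star_mulVec, hP, ← dotProduct_mulVec, hw, star_single_one, single_dotProduct, one_mul]

/-- **Block-entry shortcut** with the frame scaling `a` (`W_k = a • P e_x`; `a = 16` for character pieces, `8` for the E pieces of oct12):
`⟨a • P e_x, X w⟩ = conj a · (X w) x`. [folklore] -/
theorem blockEntry_eq {P X : Matrix ι ι ℂ} (hP : Pᴴ = P) (hPX : P * X = X * P) {w : ι → ℂ} (hw : P *ᵥ w = w)
    (a : ℂ) (x : ι) :
    star (a • (P *ᵥ Pi.single x 1)) ⬝ᵥ (X *ᵥ w) = (starRingEnd ℂ) a * (X *ᵥ w) x := by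
  rw [star_smul, smul_dotProduct, rep_dotProduct_mulVec hP hPX hw, Complex.star_def, smul_eq_mul]

/-- **Gram-entry shortcut**: `⟨a • P e_x, w⟩ = conj a · w x` for `w` fixed by the Hermitian `P`. [folklore] -/
theorem gramEntry_eq {P : Matrix ι ι ℂ} (hP : Pᴴ = P) {w : ι → ℂ} (hw : P *ᵥ w = w) (a : ℂ) (x : ι) :
    star (a • (P *ᵥ Pi.single x 1)) ⬝ᵥ w = (starRingEnd ℂ) a * w x := by
  rw [star_smul, smul_dotProduct, rep_dotProduct hP hw, Complex.star_def, smul_eq_mul]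

end Shortcut

/-! ## §2 Bitmask configurations (kernel-side data format) -/

section Bits

/-- Configuration encoded by a natural number: site `i` is `↓` (`1 : Fin 2`) iff bit `i` of `b` is set. [folklore] -/
def decodeBits (N : ℕ) (b : ℕ) : Fin N → Fin 2 := fun i => if b.testBit i then 1 else 0

/-- Encoding of a configuration as a natural number (inverse of `decodeBits` below `2^N`). [folklore] -/
def encodeBits {N : ℕ} (σ : Fin N → Fin 2) : ℕ := ∑ i : Fin N, (σ i : ℕ) * 2 ^ (i : ℕ)

/-- Number of `↓` sites of a bitmask configuration (the weight sector label: `M = N/2 − weightBits`). [folklore] -/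
def weightBits (N : ℕ) (b : ℕ) : ℕ := ((List.finRange N).filter fun i => b.testBit i).length

/-- `decodeBits` reads bit `i`. [folklore] -/
theorem decodeBits_apply (N b : ℕ) (i : Fin N) : decodeBits N b i = if b.testBit i then 1 else 0 := rfl

/-- A site is `↓` in `decodeBits N b` iff the bit is set. [folklore] -/
theorem decodeBits_eq_one_iff (N b : ℕ) (i : Fin N) : decodeBits N b i = 1 ↔ b.testBit i = true := by
  unfold decodeBits
  split_ifs with h <;> simp [h]

end Bits

/-! ## §3 The flip rule on bitmasks (kernel-side form of `pairEntry4`) -/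

section BitFlip

variable {N : ℕ}

/-- Exchange of the bits `i ≠ j` of `b` when they DIFFER = toggling both (`xor` with `2^i` then `2^j`). [folklore] -/
def flipPairBits (b i j : ℕ) : ℕ := (b ^^^ 2 ^ i) ^^^ 2 ^ j

/-- Bits of `flipPairBits`: toggled exactly at `i` and `j` (`i ≠ j`). [folklore] -/
theorem testBit_flipPairBits {i j : ℕ} (hij : i ≠ j) (b k : ℕ) :
    (flipPairBits b i j).testBit k = (if k = i ∨ k = j then !(b.testBit k) else b.testBit k) := by
  unfold flipPairBits
  rw [Nat.testBit_xor, Nat.testBit_xor, Nat.testBit_two_pow, Nat.testBit_two_pow]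
  by_cases hi : k = i
  · subst hi; simp [hij, Ne.symm hij]
  · by_cases hj : k = j
    · subst hj; simp [hi, Ne.symm hi]
    · simp [hi, hj, Ne.symm hi, Ne.symm hj]

/-- **`swapAt` on decoded bitmasks with differing bits is the double toggle.** [folklore] -/
theorem swapAt_decodeBits_of_ne (b : ℕ) {i j : Fin N} (hij : i ≠ j)
    (hdiff : b.testBit i ≠ b.testBit j) :
    swapAt (decodeBits N b) i j = decodeBits N (flipPairBits b i j) := by
  have hij' : (i : ℕ) ≠ (j : ℕ) := fun h => hij (Fin.ext h)
  funext z
  simp only [swapAt, decodeBits, testBit_flipPairBits hij']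
  by_cases hz : z = i
  · rw [if_pos hz, hz]
    simp only [true_or, if_true]
    -- value at i becomes the old value at j = ! old value at i
    cases hbi : b.testBit i <;> cases hbj : b.testBit j <;> simp_all
  · have hzi : (z : ℕ) ≠ (i : ℕ) := fun h => hz (Fin.ext h)
    rw [if_neg hz]
    by_cases hz' : z = j
    · rw [if_pos hz', hz']
      simp only [or_true, if_true]
      cases hbi : b.testBit i <;> cases hbj : b.testBit j <;> simp_all
    · have hzj : (z : ℕ) ≠ (j : ℕ) := fun h => hz' (Fin.ext h)
      rw [if_neg hz']
      simp [hzi, hzj]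

/-- Decoded bitmasks below `2^N` are equal iff the bitmasks are. [folklore] -/
theorem decodeBits_inj {b c : ℕ} (hb : b < 2 ^ N) (hc : c < 2 ^ N) :
    decodeBits N b = decodeBits N c ↔ b = c := by
  constructor
  · intro h
    apply Nat.eq_of_testBit_eq
    intro k
    by_cases hk : k < N
    · have hk' := congrFun h ⟨k, hk⟩
      simp only [decodeBits] at hk'
      cases hbk : b.testBit k <;> cases hck : c.testBit k <;> simp_all
    · have hbN : b < 2 ^ k := lt_of_lt_of_le hb (Nat.pow_le_pow_right (by norm_num) (by omega))
      have hcN : c < 2 ^ k := lt_of_lt_of_le hc (Nat.pow_le_pow_right (by norm_num) (by omega))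
      rw [Nat.testBit_lt_two_pow hbN, Nat.testBit_lt_two_pow hcN]
  · rintro rfl; rfl

/-- The integer `4·⟨σ|𝐒_i·𝐒_j|τ⟩` computed on BITMASKS (`i ≠ j`): the kernel-side twin of `pairEntry4`. [folklore] -/
def pairEntry4Bits (i j : ℕ) (b c : ℕ) : ℤ :=
  if b = c then (if b.testBit i == b.testBit j then 1 else -1)
  else if b.testBit i != b.testBit j && c == flipPairBits b i j then 2 else 0

/-- **Bit-level flip rule**: on bitmasks below `2^N`, `pairEntry4Bits` agrees with `pairEntry4` of the decoded configurations. [folklore] -/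
theorem pairEntry4Bits_eq {i j : Fin N} (hij : i ≠ j) {b c : ℕ} (hb : b < 2 ^ N) (hc : c < 2 ^ N) :
    pairEntry4Bits i j b c = pairEntry4 i j (decodeBits N b) (decodeBits N c) := by
  have hval : ∀ k : Fin N, ∀ d : ℕ, (decodeBits N d k = decodeBits N d k) := fun _ _ => rfl
  have heqv : ∀ (k l : Fin N) (d : ℕ), (decodeBits N d k = decodeBits N d l) ↔ (d.testBit k = d.testBit l) := by
    intro k l d
    simp only [decodeBits]
    cases d.testBit k <;> cases d.testBit l <;> simp
  unfold pairEntry4Bits pairEntry4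
  by_cases hbc : b = c
  · subst hbc
    simp only [if_true]
    by_cases h : b.testBit i = b.testBit j
    · rw [if_pos ((heqv i j b).mpr h)]; simp [h]
    · rw [if_neg (fun h' => h ((heqv i j b).mp h'))]
      cases hbi : b.testBit i <;> cases hbj : b.testBit j <;> simp_all
  · rw [if_neg hbc, if_neg (fun h => hbc ((decodeBits_inj hb hc).mp h))]
    by_cases hdiff : b.testBit i = b.testBit j
    · -- equal bits: no exchange term on either side
      have : ¬(decodeBits N b i ≠ decodeBits N b j ∧ decodeBits N c = swapAt (decodeBits N b) i j) := by
        rintro ⟨h1, -⟩; exact h1 ((heqv i j b).mpr hdiff)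
      rw [if_neg this]
      simp [hdiff]
    · have hflip : swapAt (decodeBits N b) i j = decodeBits N (flipPairBits b i j) := swapAt_decodeBits_of_ne b hij hdiff
      have hlt : flipPairBits b i j < 2 ^ N := by
        unfold flipPairBits
        have h1 : 2 ^ (i : ℕ) < 2 ^ N := Nat.pow_lt_pow_right (by norm_num) i.isLt
        have h2 : 2 ^ (j : ℕ) < 2 ^ N := Nat.pow_lt_pow_right (by norm_num) j.isLt
        exact Nat.xor_lt_two_pow (Nat.xor_lt_two_pow hb h1) h2
      have hne : decodeBits N b i ≠ decodeBits N b j := fun h => hdiff ((heqv i j b).mp h)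
      by_cases hcf : c = flipPairBits b i j
      · subst hcf
        have hcond : decodeBits N b i ≠ decodeBits N b j ∧
            decodeBits N (flipPairBits b i j) = swapAt (decodeBits N b) i j := ⟨hne, hflip.symm⟩
        rw [if_pos hcond]
        simp [hdiff]
      · have : ¬(decodeBits N b i ≠ decodeBits N b j ∧ decodeBits N c = swapAt (decodeBits N b) i j) := by
          rintro ⟨-, h2⟩
          rw [hflip, decodeBits_inj hc hlt] at h2
          exact hcf h2
        rw [if_neg this]
        simp [hdiff, hcf]

end BitFlip

/-! ## §4 Weighted pair lists on bitmasks: `xint4Bits` = `xint4Entry` ∘ decode -/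

section BitPairs

variable {N : ℕ}

/-- A weighted pair list with natural-number site indices (the kernel-side data format of a cut). -/
abbrev NatPairList := List (ℕ × ℕ × ℤ)

/-- All listed sites are `< N` and the two sites of each pair differ. [folklore] -/
def pairsOK (N : ℕ) (P : NatPairList) : Bool :=
  P.all fun p => decide (p.1 < N) && decide (p.2.1 < N) && decide (p.1 ≠ p.2.1)

/-- Conversion to the `Fin N`-indexed pair list of `ClusterCutFlipRule` (junk `0`-free: only used under `pairsOK`). -/
def toPairList (N : ℕ) (P : NatPairList) (hN : 0 < N) : PairList N :=
  P.map fun p => (⟨p.1 % N, Nat.mod_lt _ hN⟩, ⟨p.2.1 % N, Nat.mod_lt _ hN⟩, p.2.2)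

/-- `4·⟨b|X_P|c⟩` computed on bitmasks. [folklore] -/
def xint4Bits (P : NatPairList) (b c : ℕ) : ℤ :=
  (P.map fun p => p.2.2 * pairEntry4Bits p.1 p.2.1 b c).sum

/-- **`xint4Bits` agrees with `xint4Entry` on decoded configurations** (sites `< N`, distinct; bitmasks `< 2^N`). [folklore] -/
theorem xint4Bits_eq (P : NatPairList) (hN : 0 < N) (hP : pairsOK N P = true) {b c : ℕ} (hb : b < 2 ^ N) (hc : c < 2 ^ N) :
    xint4Bits P b c = xint4Entry (toPairList N P hN) (decodeBits N b) (decodeBits N c) := by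
  induction P with
  | nil => simp [xint4Bits, xint4Entry, toPairList]
  | cons p ps ih =>
    simp only [pairsOK, List.all_cons, Bool.and_eq_true, decide_eq_true_eq] at hP
    obtain ⟨⟨⟨hi, hj⟩, hij⟩, hps⟩ := hP
    have ih' := ih (by simpa [pairsOK] using hps)
    simp only [xint4Bits, xint4Entry, toPairList, List.map_cons, List.sum_cons] at ih' ⊢
    rw [ih']
    congr 1
    have f1 : (⟨p.1 % N, Nat.mod_lt _ hN⟩ : Fin N) = ⟨p.1, hi⟩ := Fin.ext (Nat.mod_eq_of_lt hi)
    have f2 : (⟨p.2.1 % N, Nat.mod_lt _ hN⟩ : Fin N) = ⟨p.2.1, hj⟩ := Fin.ext (Nat.mod_eq_of_lt hj)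
    rw [f1, f2]
    have hij' : (⟨p.1, hi⟩ : Fin N) ≠ ⟨p.2.1, hj⟩ := fun h => hij (congrArg Fin.val h)
    rw [pairEntry4Bits_eq (N := N) hij' hb hc]

/-- The pair list of `toPairList` has distinct sites in each pair (hypothesis of `xint4Entry_eq`). [folklore] -/
theorem toPairList_ne (P : NatPairList) (hN : 0 < N) (hP : pairsOK N P = true) :
    ∀ q ∈ toPairList N P hN, q.1 ≠ q.2.1 := by
  intro q hq
  simp only [toPairList, List.mem_map] at hq
  obtain ⟨p, hp, rfl⟩ := hq
  simp only [pairsOK, List.all_eq_true, Bool.and_eq_true, decide_eq_true_eq] at hP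
  obtain ⟨⟨hi, hj⟩, hij⟩ := hP p hp
  intro h
  have := congrArg Fin.val h
  simp only [Nat.mod_eq_of_lt hi, Nat.mod_eq_of_lt hj] at this
  exact hij this

/-- **Kernel-side entries of `4·X_P`**: for bitmasks `b, c < 2^N`,
`(xint4Bits P b c : ℂ) = 4 · (pairOp (toPairList N P)) (decodeBits N b) (decodeBits N c)`. [folklore] -/
theorem xint4Bits_eq_pairOp (P : NatPairList) (hN : 0 < N) (hP : pairsOK N P = true) {b c : ℕ}
    (hb : b < 2 ^ N) (hc : c < 2 ^ N) :
    ((xint4Bits P b c : ℤ) : ℂ) = 4 * pairOp (toPairList N P hN) (decodeBits N b) (decodeBits N c) := by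
  rw [xint4Bits_eq P hN hP hb hc, xint4Entry_eq _ (toPairList_ne P hN hP)]

end BitPairs

end Summit.HubbardSuperconductivity.HubbardLadder.ClusterCut
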